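import Mathlib
import Summits.Ventures.DiscreteObjects.Mahler.SmythFactorCount
import Summits.Ventures.DiscreteObjects.Mahler.SmythIsolationHardy

/-!
# `±1`-trinomials have at most one nonreciprocal factor (venture `DiscreteObjects`, target L)

Cell `pub-namedobj`, seat `pub-namedobj-mahler` (gen 9). Framing: lottery ticket; floor = certified
bounds/negative ranges.

A consequence of Smyth's theorem and Landau's inequality in the direction of Ljunggren's theorem on
trinomials ([McKee–Smyth, Cor. 12.3 and Exercise 12.4]): for `T = zⁿ + a zᵐ + b` with `a, b = ±1`,
`0 < m < n`, Landau's inequality (Mathlib `mahlerMeasure_le_sqrt_sum_sq_norm_coeff`) gives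
`M(T) ≤ √3 = 1.732… < θ₀² = 1.754…`, so by `smythTheta_pow_card_le_intMahlerMeasure` (Cor. 12.3) any
factorisation of `T` into nonzero integer polynomials contains AT MOST ONE factor which is nonreciprocal
(`f.reverse ≠ ±f`) with `f(0) ≠ 0` — counted with multiplicity.  (Ljunggren's theorem says more: the
non-cyclotomic part of `T` is irreducible; that is not proved here.)

* `intMahlerMeasure_trinomial_le_sqrt_three` — `M(zⁿ + a zᵐ + b) ≤ √3`;
* `card_nonreciprocal_factors_trinomial_le_one` — at most one nonreciprocal factor.
-/

namespace Summit.Ventures.DiscreteObjects.Mahler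

open Polynomial Finset

/-- **Landau for `±1`-trinomials:** `M(zⁿ + a zᵐ + b) ≤ √3` for `a, b = ±1`, `0 < m < n`. -/
theorem intMahlerMeasure_trinomial_le_sqrt_three {n m : ℕ} (hm : 0 < m) (hmn : m < n) {a b : ℤ}
    (ha : a = 1 ∨ a = -1) (hb : b = 1 ∨ b = -1) :
    intMahlerMeasure (X ^ n + C a * X ^ m + C b : ℤ[X]) ≤ Real.sqrt 3 := by
  unfold intMahlerMeasure
  set p : ℂ[X] := C (1 : ℂ) * X ^ n + C (a : ℂ) * X ^ m + C (b : ℂ) * X ^ 0 with hp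
  have hmap : ((X ^ n + C a * X ^ m + C b : ℤ[X]).map (Int.castRingHom ℂ)) = p := by
    rw [hp]
    simp only [Polynomial.map_add, Polynomial.map_mul, Polynomial.map_pow, Polynomial.map_X,
      Polynomial.map_C]
    simp only [eq_intCast, map_one, pow_zero, one_mul, mul_one]
  rw [hmap]
  refine le_trans (mahlerMeasure_le_sqrt_sum_sq_norm_coeff p) (Real.sqrt_le_sqrt ?_)
  have hsum := sum_norm_sq_coeff_trinomial (1 : ℂ) (a : ℂ) (b : ℂ) (m₀ := n) (m₁ := m) (m₂ := 0)
    (by omega) (by omega) (by omega)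
  rw [← hp] at hsum
  have ha1 : ‖(a : ℂ)‖ = 1 := by rcases ha with h | h <;> simp [h]
  have hb1 : ‖(b : ℂ)‖ = 1 := by rcases hb with h | h <;> simp [h]
  rw [norm_one, ha1, hb1] at hsum
  norm_num at hsum
  have hle : ∑ i ∈ p.support, ‖p.coeff i‖ ^ 2 ≤ ∑ i ∈ range (p.natDegree + 1), ‖p.coeff i‖ ^ 2 :=
    sum_le_sum_of_subset_of_nonneg supp_subset_range_natDegree_succ (fun i _ _ => sq_nonneg ‖p.coeff i‖)
  linarith

/-- **A `±1`-trinomial has at most one nonreciprocal factor.**  If `zⁿ + a zᵐ + b = ∏ F`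
(`a, b = ±1`, `0 < m < n`, all factors nonzero) and `G ≤ F` consists of factors `f` with `f(0) ≠ 0`,
`f.reverse ≠ ±f`, then `|G| ≤ 1`. -/
theorem card_nonreciprocal_factors_trinomial_le_one {n m : ℕ} (hm : 0 < m) (hmn : m < n) {a b : ℤ}
    (ha : a = 1 ∨ a = -1) (hb : b = 1 ∨ b = -1) {F G : Multiset ℤ[X]} (hF : ∀ f ∈ F, f ≠ 0)
    (hprod : F.prod = X ^ n + C a * X ^ m + C b) (hGF : G ≤ F)
    (hG : ∀ f ∈ G, f.coeff 0 ≠ 0 ∧ f.reverse ≠ f ∧ f.reverse ≠ -f) : Multiset.card G ≤ 1 := by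
  have h1 := smythTheta_pow_card_le_intMahlerMeasure hF hGF hG
  rw [hprod] at h1
  have h2 := intMahlerMeasure_trinomial_le_sqrt_three hm hmn ha hb
  have h3 : Real.sqrt 3 < 1754 / 1000 := by rw [Real.sqrt_lt' (by norm_num)]; norm_num
  have hθ := smythTheta_gt
  by_contra hc
  push Not at hc
  -- `θ₀² ≤ θ₀^{|G|} ≤ √3 < θ₀²`
  have hθ1 : 1 ≤ smythTheta := by linarith
  have h4 : smythTheta ^ 2 ≤ smythTheta ^ Multiset.card G := pow_le_pow_right₀ hθ1 (by omega)
  nlinarith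

end Summit.Ventures.DiscreteObjects.Mahler
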